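import Mathlib.Analysis.InnerProductSpace.Calculus
import Summits.FinalStateConjecture.FinalStateConjecture.Theses.ZeroEnergyKerrOrBomb
import Summits.FinalStateConjecture.FinalStateConjecture.Theorems.ZeroEnergyKerrOrBombKerrOrBombOfCruxes
import Summits.FinalStateConjecture.FinalStateConjecture.Theorems.ZeroEnergyKerrOrBombErgoregionBomb
import Literature.Geometry.Lorentzian.GeodesicRayEndless
import Literature.Analysis.ODE.QuadraticDragEscape

/-!
# Crux `KerrOrBomb` (stmt-FinalStateConjecture-10689) — line `Dock` (lead's skeleton, reshape 3)

Lead: prover-line-stmt-FinalStateConjecture-10689-0, 2026-08-16.  Reshaped from the planner's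
`Cruxes/KerrOrBomb/DockIdeator1.lean` (`kerrOrBomb_of_zeroEnergyRigidity : BS → NI → hEnd →
ZeroEnergyRigidity → KerrOrBomb`).  State after cycle 1:

* the two causality facts `BS` (Bernal–Sánchez 2007, Thm. 3.2) and `NI` (O'Neill 1983, Ch. 14,
  Lemma 13) are DISCHARGED tree theorems and `hEnd` (an affinely parametrised geodesic ray with
  nowhere-zero velocity has no future endpoint) is now a tree theorem too; the sibling item
  stmt-FinalStateConjecture-10691 (`ErgoregionBomb`) was CLOSED with them
  (`Theorems/ZeroEnergyKerrOrBombErgoregionBomb.lean`, `ErgoregionBomb_of`, by the 10691 line lead —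
  the two lines met on `hEnd` and split it);
* stub A `stub_escape_of_quadraticDrag` — CLOSED: `Literature.Analysis.ODE.exists_lt_norm_of_norm_accel_le_mul_sq`
  (`Literature/Analysis/ODE/QuadraticDragEscape.lean`, p86586, this lead's proof: escape under
  quadratic drag in an inner product space, O'Neill 1983 Ch. 5 proof of Prop. 7);
* stub B `stub_not_tendsto_of_isGeodesicOn` — CLOSED: `IsGeodesicOn.not_tendsto_nhds_of_velocity_ne_zero`
  (`Literature/Geometry/Lorentzian/GeodesicRayEndless.lean`, p87209, landed by the 10691 lead from
  this lead's rc-0 work file attached as evidence; no interiority hypothesis);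
* stub C `stub_zeroEnergyRigidity` — the sibling crux stmt-FinalStateConjecture-10690 BY NAME (an
  item, not a worker stub): the crux is `blocked-on: stmt-FinalStateConjecture-10690`.

Composition (kernel-checked, `sorry` ONLY in stub C): `KerrOrBomb_of : KerrOrBomb` through the
landed glue `KerrOrBombOfCruxes_proof` and the landed `ErgoregionBomb_of` — also landed as
`Theorems/ZeroEnergyKerrOrBombKerrOrBombDock.lean` (`KerrOrBombDock.kerrOrBomb_of_zeroEnergyRigidity :
ZeroEnergyRigidity → KerrOrBomb`).  Mode stability (h6) is never spent — as every audit of the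
typed decl found (Disproof F2/F6, both triage files, cards typed-crux-docks-on-siblings /
five-stubs-verbatim): as typed the crux is `CoreRigidityGH` with idle h5/h6.
-/

noncomputable section

-- `Summit.FinalStateConjecture.FinalStateConjecture.…`: summit = problem name (single-conjunct summit, D-0017).
set_option linter.dupNamespace false

namespace Summit.FinalStateConjecture.FinalStateConjecture.Theorems.KerrOrBomb.Dock

open Set Filter Function Literature.Geometry.Lorentzian
open scoped Manifold ContDiff Topology InnerProductSpace
open Summit.FinalStateConjecture.FinalStateConjecture.Theses.ZeroEnergyKerrOrBomb
  (KerrOrBomb ZeroEnergyRigidity ErgoregionBomb)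

/-! ## The three stubs (reshape 3: A and B closed by Literature imports; `sorry` only in C) -/

/-- **Stub A (analysis) — CLOSED** by `Literature.Analysis.ODE.exists_lt_norm_of_norm_accel_le_mul_sq`
(`QuadraticDragEscape.lean`, p86586).  ESCAPE UNDER QUADRATIC DRAG: in a real inner product space, a
curve `U` with velocity `W = U'` and acceleration `A = W'` on `[T₀, ∞)` satisfying
`‖A t‖ ≤ C ‖W t‖²` (`C > 0`) with `W` nowhere zero leaves the closed ball of radius `1/(2C)`
about the origin at some time `t ≥ T₀`.  O'Neill 1983, Ch. 5, proof of Prop. 7 (p. 130). -/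
theorem stub_escape_of_quadraticDrag {F : Type*} [NormedAddCommGroup F] [InnerProductSpace ℝ F]
    {U W A : ℝ → F} {T₀ C : ℝ} (hC : 0 < C)
    (hU : ∀ t, T₀ ≤ t → HasDerivAt U (W t) t) (hW : ∀ t, T₀ ≤ t → HasDerivAt W (A t) t)
    (hA : ∀ t, T₀ ≤ t → ‖A t‖ ≤ C * ‖W t‖ ^ 2) (hW0 : ∀ t, T₀ ≤ t → W t ≠ 0) :
    ∃ t, T₀ ≤ t ∧ 1 / (2 * C) < ‖U t‖ :=
  Literature.Analysis.ODE.exists_lt_norm_of_norm_accel_le_mul_sq hC hU hW hA hW0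

/-- **Stub B (manifold wrapper) — CLOSED** by `IsGeodesicOn.not_tendsto_nhds_of_velocity_ne_zero`
(`GeodesicRayEndless.lean`, p87209).  A geodesic ray `γ|[a, ∞)` of a `C¹` covariant derivative on
the tangent bundle of a Hausdorff manifold, with nowhere-zero velocity, does not converge to any
point of the manifold as the affine parameter tends to `+∞`.  O'Neill 1983, Ch. 5, Lemma 8. -/
theorem stub_not_tendsto_of_isGeodesicOn
    {E : Type*} [NormedAddCommGroup E] [NormedSpace ℝ E] [FiniteDimensional ℝ E]
    {H : Type*} [TopologicalSpace H] {I : ModelWithCorners ℝ E H}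
    {M : Type*} [TopologicalSpace M] [ChartedSpace H M] [IsManifold I ∞ M] [T2Space M]
    {cov : CovariantDerivative I E (TangentSpace I : M → Type _)}
    [CovariantDerivative.ContMDiffCovariantDerivative cov 1]
    {γ : ℝ → M} {a : ℝ} (hγ : IsGeodesicOn cov γ (Ici a))
    (hv : ∀ t, a ≤ t → velocity I γ t ≠ 0) (p : M) : ¬ Tendsto γ atTop (𝓝 p) :=
  hγ.not_tendsto_nhds_of_velocity_ne_zero hv p

/-- **Stub C = the sibling crux stmt-FinalStateConjecture-10690, BY NAME** (not a worker stub):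
the crux is `blocked-on` it. -/
theorem stub_zeroEnergyRigidity : ZeroEnergyRigidity := by
  sorry

/-! ## Composition (no `sorry` below) -/

/-- `ErgoregionBomb` (item stmt-FinalStateConjecture-10691) BY NAME — the landed `ErgoregionBomb_of`
(vacuous under h4: Bernal–Sánchez + non-imprisonment + stub B's endlessness of geodesic rays). -/
theorem ergoregionBomb_of : ErgoregionBomb :=
  ErgoregionBomb_of

/-- **The line closes the crux BY NAME**: `KerrOrBomb` from the sibling crux (stub C) and the
landed `ErgoregionBomb`, through the landed glue `KerrOrBombOfCruxes_proof` (= the landed dock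
`KerrOrBombDock.kerrOrBomb_of_zeroEnergyRigidity stub_zeroEnergyRigidity`). -/
theorem KerrOrBomb_of : KerrOrBomb :=
  KerrOrBombOfCruxes_proof stub_zeroEnergyRigidity ergoregionBomb_of

end Summit.FinalStateConjecture.FinalStateConjecture.Theorems.KerrOrBomb.Dock

end
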